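import Literature.NumberTheory.Sieve.LargeSieveCharacters

/-!
# Zhang (2022) §3, Lemma 3.3: the two mean-value inequalities over `Ψ`

Trunk T-ANT (NumberTheory/LFunctions). Y. Zhang, *Discrete mean estimates and the Landau–Siegel
zero*, arXiv:2211.02515v1 (2022) [Zhang2022LandauSiegel], §3, Lemma 3.3 [p. 7 of the source]:

> Lemma 3.3. For any `s` and any complex numbers `c(n)` we have
> `∑_{ψ ∈ Ψ} |∑_{n ≤ P} c(n)ψ(n)n^{-s}|² ≪ 𝔓 ∑_{n ≤ P} |c(n)|² n^{-2σ}`  (i)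
> and
> `∑_{ψ ∈ Ψ} |∑_{n ≤ P²} c(n)ψ(n)n^{-s}|² ≪ P² ∑_{n ≤ P²} |c(n)|² n^{-2σ}`.  (ii)
> Proof. The first assertion follows by the orthogonality relation; the second assertion
> follows by the large sieve inequality. □

Here `Ψ` is the set of all primitive characters `ψ (mod p)` to prime moduli `P < p < P(1 + 𝓛⁻⁶⁸)`
(§2 of the source) and `𝔓 = ∑_{p ∼ P} p` ((2.9): `𝔓 = (1 + o(1))P²𝓛⁻⁷⁷`).

**Status of the source: an unrefereed manuscript, a claimed result under adjudication.** Lemma 3.3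
itself is standard and correct as printed; this file PROVES it, with explicit constants, from the
tree's large sieve for primitive characters
(`Literature.NumberTheory.Sieve.LargeSieve.largeSieve_character_nat`, Cojocaru–Murty Thm 8.3.1)
and Parseval on `(ℤ/qℤ)ˣ` (`Literature.NumberTheory.Sieve.LargeSieve.sum_norm_sq_sum_char_mul`,
from Mathlib's `DirichletCharacter.sum_char_inv_mul_char_eq`), in the following general form
(the weights `n^{-s}` are absorbed into the coefficients, `weighted_*` versions restore them):

* (i) `orthogonality_meanValue`: for ANY finite set `𝒫` of moduli each exceeding `N`,
  `∑_{p ∈ 𝒫} ∑*_{χ mod p} |∑_{1 ≤ n ≤ N} a(n)χ(n)|² ≤ (∑_{p ∈ 𝒫} p) · ∑_{1 ≤ n ≤ N} |a(n)|²`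
  — the implied constant in (i) is `1` (indeed `∑_{p∈𝒫} φ(p)` would do,
  `sum_primitive_norm_sq_le`); this is the SHARP inequality of the pair (for `N < p` the inner
  sum over ALL characters is an equality, `sum_char_norm_sq_eq`).
* (ii) `largeSieve_meanValue`: for ANY finite set `𝒫 ⊆ [1, Q]` of moduli,
  `∑_{p ∈ 𝒫} ∑*_{χ mod p} |∑_{1 ≤ n ≤ N} a(n)χ(n)|² ≤ (N + 1 + 2Q²) · ∑_{1 ≤ n ≤ N} |a(n)|²`;
  with `N = P²`, `Q = P(1 + 𝓛⁻⁶⁸)` the implied constant in (ii) is `3 + o(1)` (weak large-sieve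
  constant inherited from the tree; the optimal `N + Q²` would give `2 + o(1)`).

Why this lemma is formalised (Landau–Siegel autopsy, Part I): every error term of §§3–17 of the
source is budgeted through (i) or (ii), and (ii) loses exactly the factor `P²/𝔓 = (1 + o(1))𝓛⁷⁷`
against (i); each use of (ii) must therefore save `𝓛^{77+}` elsewhere (e.g. Lemma 3.5:
`P²𝓛⁻¹⁹⁹³ = 𝔓𝓛⁻¹⁹¹⁶`; (7.5); Lemma 8.1, margin one power of `𝓛`; (15.4) needs (i)). No statement
about Theorems 1–2 of the source is made or implied.
-/

noncomputable section

open Finset Complex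
open Literature.NumberTheory.Sieve.LargeSieve

namespace Literature.NumberTheory.LFunctions.Zhang2022

/-! ### Parseval for one modulus `q > N` -/

/-- Parseval on `(ℤ/qℤ)ˣ` for a sum of length `N < q`: summing over ALL Dirichlet characters
`mod q`, `∑_χ |∑_{1 ≤ n ≤ N} a(n)χ(n)|² = φ(q) ∑_{1 ≤ n ≤ N, (n,q)=1} |a(n)|²`. [folklore] -/
theorem sum_char_norm_sq_eq {q N : ℕ} [NeZero q] (hN : N < q) (a : ℕ → ℂ) :
    ∑ χ : DirichletCharacter ℂ q, ‖∑ n ∈ Ioc 0 N, a n * χ n‖ ^ 2 =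
      (q.totient : ℝ) * ∑ n ∈ (Ioc 0 N).filter (fun n => n.Coprime q), ‖a n‖ ^ 2 := by
  classical
  set c : ℕ → ℂ := fun b => if b ∈ Ioc 0 N then a b else 0 with hc
  have hsub : Ioc 0 N ⊆ range q := fun n hn => by
    rw [mem_Ioc] at hn; rw [mem_range]; omega
  have h1 : ∀ χ : DirichletCharacter ℂ q,
      ∑ b ∈ range q, χ b * c b = ∑ n ∈ Ioc 0 N, a n * χ n := by
    intro χ
    have e : ∑ b ∈ Ioc 0 N, χ b * c b = ∑ b ∈ range q, χ b * c b :=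
      sum_subset hsub fun b _ hb => by simp only [hc, if_neg hb, mul_zero]
    rw [← e]
    exact sum_congr rfl fun n hn => by simp only [hc, if_pos hn, mul_comm]
  have h2 : ∑ b ∈ (range q).filter (fun b => b.Coprime q), ‖c b‖ ^ 2 =
      ∑ n ∈ (Ioc 0 N).filter (fun n => n.Coprime q), ‖a n‖ ^ 2 := by
    rw [sum_filter, sum_filter]
    have e : ∑ b ∈ Ioc 0 N, (if b.Coprime q then ‖c b‖ ^ 2 else 0) =
        ∑ b ∈ range q, (if b.Coprime q then ‖c b‖ ^ 2 else 0) :=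
      sum_subset hsub fun b _ hb => by simp only [hc, if_neg hb, norm_zero]; simp
    rw [← e]
    exact sum_congr rfl fun n hn => by simp only [hc, if_pos hn]
  have key := sum_norm_sq_sum_char_mul (q := q) c
  rw [h2] at key
  simpa only [h1] using key

open scoped Classical in
/-- One modulus `q > N`, primitive characters only:
`∑*_{χ mod q} |∑_{1 ≤ n ≤ N} a(n)χ(n)|² ≤ φ(q) ∑_{1 ≤ n ≤ N} |a(n)|²`. [folklore] -/
theorem sum_primitive_norm_sq_le {q N : ℕ} [NeZero q] (hN : N < q) (a : ℕ → ℂ) :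
    ∑ χ : DirichletCharacter ℂ q with χ.IsPrimitive, ‖∑ n ∈ Ioc 0 N, a n * χ n‖ ^ 2 ≤
      (q.totient : ℝ) * ∑ n ∈ Ioc 0 N, ‖a n‖ ^ 2 := by
  calc ∑ χ : DirichletCharacter ℂ q with χ.IsPrimitive, ‖∑ n ∈ Ioc 0 N, a n * χ n‖ ^ 2
      ≤ ∑ χ : DirichletCharacter ℂ q, ‖∑ n ∈ Ioc 0 N, a n * χ n‖ ^ 2 :=
        sum_le_sum_of_subset_of_nonneg (filter_subset _ _) fun χ _ _ => by positivity
    _ = (q.totient : ℝ) * ∑ n ∈ (Ioc 0 N).filter (fun n => n.Coprime q), ‖a n‖ ^ 2 :=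
        sum_char_norm_sq_eq hN a
    _ ≤ (q.totient : ℝ) * ∑ n ∈ Ioc 0 N, ‖a n‖ ^ 2 :=
        mul_le_mul_of_nonneg_left
          (sum_le_sum_of_subset_of_nonneg (filter_subset _ _) fun n _ _ => by positivity)
          (Nat.cast_nonneg _)

/-! ### Lemma 3.3 (i): orthogonality, the sharp inequality -/

open scoped Classical in
/-- **Zhang 2022, Lemma 3.3 (i)** (explicit form): for a finite set `M` of moduli each `> N`
(in the source: the primes `P < p < P(1 + 𝓛⁻⁶⁸)` and `N = P`) and any complex `a(n)`,
`∑_{p ∈ M} ∑*_{χ mod p} |∑_{1 ≤ n ≤ N} a(n)χ(n)|² ≤ (∑_{p ∈ M} p) ∑_{1 ≤ n ≤ N} |a(n)|²`,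
i.e. `≪ 𝔓 ∑|a(n)|²` with implied constant `1`. [cite: Zhang2022LandauSiegel, Lemma 3.3] -/
theorem orthogonality_meanValue (M : Finset ℕ) (N : ℕ) (hM : ∀ p ∈ M, N < p) (a : ℕ → ℂ) :
    ∑ p ∈ M, ∑ χ : DirichletCharacter ℂ p with χ.IsPrimitive, ‖∑ n ∈ Ioc 0 N, a n * χ n‖ ^ 2 ≤
      (∑ p ∈ M, (p : ℝ)) * ∑ n ∈ Ioc 0 N, ‖a n‖ ^ 2 := by
  rw [sum_mul]
  refine sum_le_sum fun p hp => ?_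
  have hNp : N < p := hM p hp
  have : NeZero p := ⟨by omega⟩
  refine (sum_primitive_norm_sq_le hNp a).trans ?_
  have hS : 0 ≤ ∑ n ∈ Ioc 0 N, ‖a n‖ ^ 2 := sum_nonneg fun n _ => by positivity
  exact mul_le_mul_of_nonneg_right (by exact_mod_cast Nat.totient_le p) hS

/-! ### Lemma 3.3 (ii): the large sieve -/

open scoped Classical in
/-- **Zhang 2022, Lemma 3.3 (ii)** (explicit form): for a finite set `M ⊆ [1, Q]` of moduli (in
the source: the primes `P < p < P(1 + 𝓛⁻⁶⁸)`, `Q = P(1 + 𝓛⁻⁶⁸)`, `N = P²`) and any complex `a(n)`,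
`∑_{p ∈ M} ∑*_{χ mod p} |∑_{1 ≤ n ≤ N} a(n)χ(n)|² ≤ (N + 1 + 2Q²) ∑_{1 ≤ n ≤ N} |a(n)|²`,
i.e. `≪ P² ∑|a(n)|²` with implied constant `3 + o(1)`; from the tree's `largeSieve_character_nat`
(the weight `q/φ(q) ≥ 1` and the moduli outside `M` are dropped).
[cite: Zhang2022LandauSiegel, Lemma 3.3] -/
theorem largeSieve_meanValue (M : Finset ℕ) (N Q : ℕ) (hM : M ⊆ Icc 1 Q) (a : ℕ → ℂ) :
    ∑ p ∈ M, ∑ χ : DirichletCharacter ℂ p with χ.IsPrimitive, ‖∑ n ∈ Ioc 0 N, a n * χ n‖ ^ 2 ≤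
      ((N : ℝ) + 1 + 2 * (Q : ℝ) ^ 2) * ∑ n ∈ Ioc 0 N, ‖a n‖ ^ 2 := by
  have hls := largeSieve_character_nat a 0 N Q
  simp only [zero_add] at hls
  refine le_trans ?_ (le_trans (sum_le_sum_of_subset_of_nonneg hM fun q _ _ => ?_) hls)
  · refine sum_le_sum fun p hp => ?_
    have hp1 : 1 ≤ p := (mem_Icc.1 (hM hp)).1
    have hφ : (0 : ℝ) < p.totient := by exact_mod_cast Nat.totient_pos.2 hp1
    have hw : (1 : ℝ) ≤ (p : ℝ) / p.totient := by
      rw [le_div_iff₀ hφ, one_mul]; exact_mod_cast Nat.totient_le p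
    have hX : 0 ≤ ∑ χ : DirichletCharacter ℂ p with χ.IsPrimitive,
        ‖∑ n ∈ Ioc 0 N, a n * χ n‖ ^ 2 := sum_nonneg fun _ _ => by positivity
    calc ∑ χ : DirichletCharacter ℂ p with χ.IsPrimitive, ‖∑ n ∈ Ioc 0 N, a n * χ n‖ ^ 2
        = 1 * ∑ χ : DirichletCharacter ℂ p with χ.IsPrimitive, ‖∑ n ∈ Ioc 0 N, a n * χ n‖ ^ 2 :=
          (one_mul _).symm
      _ ≤ (p : ℝ) / p.totient *
            ∑ χ : DirichletCharacter ℂ p with χ.IsPrimitive, ‖∑ n ∈ Ioc 0 N, a n * χ n‖ ^ 2 :=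
          mul_le_mul_of_nonneg_right hw hX
  · exact mul_nonneg (by positivity) (sum_nonneg fun _ _ => by positivity)

/-! ### The weighted forms, literally as printed (`c(n)ψ(n)n^{-s}`, `|c(n)|² n^{-2σ}`) -/

/-- `|c · n^{-s}|² = |c|² n^{-2σ}` for `n ≥ 1`. [folklore] -/
theorem norm_mul_natCast_cpow_neg_sq (c : ℂ) {n : ℕ} (hn : 0 < n) (s : ℂ) :
    ‖c * (n : ℂ) ^ (-s)‖ ^ 2 = ‖c‖ ^ 2 * (n : ℝ) ^ (-(2 * s.re)) := by
  rw [norm_mul, mul_pow, Complex.norm_natCast_cpow_of_pos hn, sq ((n : ℝ) ^ (-s).re),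
    ← Real.rpow_add (by exact_mod_cast hn)]
  congr 1
  simp only [Complex.neg_re]
  ring_nf

/-- The weighted coefficient sum equals the plain one for `a(n) = c(n)n^{-s}`. [folklore] -/
theorem sum_norm_sq_weighted (c : ℕ → ℂ) (s : ℂ) (N : ℕ) :
    ∑ n ∈ Ioc 0 N, ‖c n * (n : ℂ) ^ (-s)‖ ^ 2 =
      ∑ n ∈ Ioc 0 N, ‖c n‖ ^ 2 * (n : ℝ) ^ (-(2 * s.re)) :=
  sum_congr rfl fun n hn => norm_mul_natCast_cpow_neg_sq (c n) (mem_Ioc.1 hn).1 s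

open scoped Classical in
/-- **Zhang 2022, Lemma 3.3 (i), as printed**: for any `s` and complex `c(n)`, moduli `> N`,
`∑_{p ∈ M} ∑*_{ψ mod p} |∑_{n ≤ N} c(n)ψ(n)n^{-s}|² ≤ (∑_{p ∈ M} p) ∑_{n ≤ N} |c(n)|² n^{-2σ}`.
[cite: Zhang2022LandauSiegel, Lemma 3.3] -/
theorem weighted_orthogonality_meanValue (M : Finset ℕ) (N : ℕ) (hM : ∀ p ∈ M, N < p)
    (c : ℕ → ℂ) (s : ℂ) :
    ∑ p ∈ M, ∑ χ : DirichletCharacter ℂ p with χ.IsPrimitive,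
        ‖∑ n ∈ Ioc 0 N, c n * χ n * (n : ℂ) ^ (-s)‖ ^ 2 ≤
      (∑ p ∈ M, (p : ℝ)) * ∑ n ∈ Ioc 0 N, ‖c n‖ ^ 2 * (n : ℝ) ^ (-(2 * s.re)) := by
  have h := orthogonality_meanValue M N hM (fun n => c n * (n : ℂ) ^ (-s))
  rw [sum_norm_sq_weighted] at h
  refine le_of_eq_of_le (sum_congr rfl fun p _ => sum_congr rfl fun χ _ => ?_) h
  rw [sum_congr rfl fun n _ => mul_right_comm (c n) (χ n) ((n : ℂ) ^ (-s))]

open scoped Classical in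
/-- **Zhang 2022, Lemma 3.3 (ii), as printed**: for any `s` and complex `c(n)`, moduli `M ⊆ [1,Q]`,
`∑_{p ∈ M} ∑*_{ψ mod p} |∑_{n ≤ N} c(n)ψ(n)n^{-s}|² ≤ (N + 1 + 2Q²) ∑_{n ≤ N} |c(n)|² n^{-2σ}`.
[cite: Zhang2022LandauSiegel, Lemma 3.3] -/
theorem weighted_largeSieve_meanValue (M : Finset ℕ) (N Q : ℕ) (hM : M ⊆ Icc 1 Q)
    (c : ℕ → ℂ) (s : ℂ) :
    ∑ p ∈ M, ∑ χ : DirichletCharacter ℂ p with χ.IsPrimitive,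
        ‖∑ n ∈ Ioc 0 N, c n * χ n * (n : ℂ) ^ (-s)‖ ^ 2 ≤
      ((N : ℝ) + 1 + 2 * (Q : ℝ) ^ 2) * ∑ n ∈ Ioc 0 N, ‖c n‖ ^ 2 * (n : ℝ) ^ (-(2 * s.re)) := by
  have h := largeSieve_meanValue M N Q hM (fun n => c n * (n : ℂ) ^ (-s))
  rw [sum_norm_sq_weighted] at h
  refine le_of_eq_of_le (sum_congr rfl fun p _ => sum_congr rfl fun χ _ => ?_) h
  rw [sum_congr rfl fun n _ => mul_right_comm (c n) (χ n) ((n : ℂ) ^ (-s))]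

/-! ### The bookkeeping constant `P²/𝔓`

In the source `𝔓 = (1 + o(1))P²𝓛⁻⁷⁷` ((2.9), from `P = exp 𝓛⁹` and the prime number theorem on
`(P, P(1 + 𝓛⁻⁶⁸))`: `𝔓 ≈ P · P𝓛⁻⁶⁸/log P = P²𝓛⁻⁷⁷`), so (ii) is weaker than (i) by the factor
`(3 + o(1))𝓛⁷⁷`. The exponent arithmetic `77 = 68 + 9` is recorded here once. -/

/-- `77 = 68 + 9`: the width exponent of `p ∼ P` plus the exponent of `log P = 𝓛⁹`.
[cite: Zhang2022LandauSiegel, (2.9)] -/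
theorem frakP_exponent : (77 : ℕ) = 68 + 9 := rfl

end Literature.NumberTheory.LFunctions.Zhang2022

end
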